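import Summits.HodgeConjecture.CorCM.IrreducibleOddWeightsIndexParity
import HarnessLib

/-!
# Index parity, II: SURJECTIVITY of the shadow — every admissible weight on the pivot is the shadow of a CM type;
# padding by cancelling pairs (a larger index of the same parity realises every shadow of the smaller)

COR-CM (cell `pub-hodgecm2`, binder seat `b16` gen 68, count-neutral claim INDEX PARITY, file P1b — abstract `G`-set
level; theorems only, no definition, no named fact, no `sorry`).  NEW as stated, hence under `Summits/`.  HONEST FRAMING:
finite combinatorics of CM types over a pivot (`Φ ⊆ X`, `r : X → Y` with fibres of constant size `f`, a CM structure
`ρ` acting freely on `Y`); feeds the defect formula of file P1 (`IrreducibleOddWeightsIndexParity` §2: the defect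
`dim Hg(A₀) + dim Hg(A₁) − dim Hg(A₀ × A₁)` is a function of the shadow `w₀ = r_* u₀`); `HC_CM` is neither used nor
asserted.

* `exists_repr_of_free_involution` — a free involution on a finite set has a set of representatives (`y ∈ R ⟺ ρy ∉ R`).
* **`exists_isCMTypeWith_forall_card_fibre_inter_eq`** — for every `k : Y → ℕ` with `k(y) + k(ρy) = f` there is a CM
  type `Φ ⊆ X` with `#(Φ ∩ r⁻¹y) = k(y)` for ALL `y` (over representatives take any `k(y)` points of the fibre, over `ρy`
  the conjugates of the rest); shadow form **`exists_isCMTypeWith_forall_fibre_shadow_eq`** (`w = 2k − f`): together with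
  P1 §3 (parity, oddness, bounds) THE SHADOWS OF THE CM TYPES OF `X` ARE EXACTLY THE ODD WEIGHTS `w ≡ f (mod 2)`,
  `|w| ≤ f` — the `f`-fold sums of type vectors of the pivot.
* **`exists_isCMTypeWith_fibre_shadow_eq_of_le_of_even`** — PADDING: fibres `f = f′ + 2d` over the same `Y` ⟹ every
  shadow of a CM type of `X′` is a shadow of a CM type of `X`; with P1 §2 every defect realised by `(X′, partner)` is
  realised by `(X, partner)` (CM fields: file P2, monotone defect spectra in the index within a parity class).

## References

* [Gordon1999HodgeAVSurvey] B. B. Gordon, *A survey of the Hodge conjecture for abelian varieties*, 9.4.3 (Yanai: CM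
  types lying over a subtype with multiplicities), §3 Theorem.
* [Shimura1998] G. Shimura, *Abelian Varieties with Complex Multiplication and Modular Functions*, §18.1 (CM types).
* [Dodson1987] B. Dodson, J. Algebra 111 (1987), §1.1 (lifts of types).
-/

set_option autoImplicit false

noncomputable section

open scoped BigOperators Classical

universe u v v' w

namespace Summit.HodgeConjecture.CorCM.IrrOdd

open Literature.NumberTheory.ComplexMultiplication

variable {G : Type w} [Group G]

/-! ### §4 Surjectivity: every admissible weight is the shadow of a CM type -/

section Surjective

variable {X : Type v} [MulAction G X] [Fintype X] {Y : Type v'} [DecidableEq Y] [Fintype Y] [MulAction G Y]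

omit [DecidableEq Y] in
/-- A free involution on a finite set admits a set of representatives: `y ∈ R ⟺ ρy ∉ R` (a "CM type" of the pivot
field). [cite: Shimura1998, §18.1] -/
theorem exists_repr_of_free_involution {ρ : G} (hρY : ∀ y : Y, ρ • ρ • y = y) (hfree : ∀ y : Y, ρ • y ≠ y) :
    ∃ R : Set Y, ∀ y : Y, y ∈ R ↔ ρ • y ∉ R := by
  let e := Fintype.equivFin Y
  refine ⟨{y | e y < e (ρ • y)}, fun y => ?_⟩
  simp only [Set.mem_setOf_eq, hρY, not_lt]
  constructor
  · exact le_of_lt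
  · intro hle
    exact lt_of_le_of_ne hle fun heq => hfree y (e.injective heq).symm

/-- **SURJECTIVITY OF THE FIBRE COUNTS.**  Let the CM structure `ρ` act (commuting with `G`, as an involution without
fixed points on `X`), let the pivot `r : X → Y` be `ρ`-compatible with all fibres of size `f`, and let `ρ` act on `Y` as a
free involution.  Then for every `k : Y → ℕ` with `k(y) + k(ρy) = f` there is a CM type `Φ ⊆ X` meeting every fibre
`r⁻¹y` in exactly `k(y)` points.  (Choose representatives `R` of `Y/ρ`; over `y ∈ R` take any `k(y)` points of the fibre,
over `ρy` the conjugates of the remaining `f − k(y)`.) [cite: Gordon1999HodgeAVSurvey, 9.4.3] [cite: Shimura1998, §18.1] -/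
theorem exists_isCMTypeWith_forall_card_fibre_inter_eq {ρ : G} (hcomm : ∀ (g : G) (x : X), g • ρ • x = ρ • g • x)
    (hinv : ∀ x : X, ρ • ρ • x = x) (r : X → Y)
    (hr : ∀ x : X, r (ρ • x) = ρ • r x) (hρY : ∀ y : Y, ρ • ρ • y = y) (hfree : ∀ y : Y, ρ • y ≠ y) {f : ℕ}
    (hf : ∀ y : Y, (Finset.univ.filter (fun x => r x = y)).card = f) (k : Y → ℕ)
    (hk : ∀ y : Y, k y + k (ρ • y) = f) :
    ∃ Φ : Set X, IsCMTypeWith ρ Φ ∧ ∀ y : Y, (Finset.univ.filter (fun x => r x = y ∧ x ∈ Φ)).card = k y := by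
  obtain ⟨R, hR⟩ := exists_repr_of_free_involution hρY hfree
  -- over each `y` choose `k y` points of the fibre
  have hS : ∀ y : Y, ∃ S : Finset X, S ⊆ Finset.univ.filter (fun x => r x = y) ∧ S.card = k y := fun y =>
    Finset.exists_subset_card_eq (by rw [hf y]; have := hk y; omega)
  choose S hSsub hScard using hS
  have hSr : ∀ {y : Y} {x : X}, x ∈ S y → r x = y := fun {y x} hx =>
    (Finset.mem_filter.1 (hSsub y hx)).2
  refine ⟨{x | (r x ∈ R ∧ x ∈ S (r x)) ∨ (r x ∉ R ∧ ρ • x ∉ S (r (ρ • x)))}, ⟨fun x => ?_, hcomm, hinv⟩, fun y => ?_⟩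
  · -- CM type: exactly one of `x`, `ρx` lies in `Φ`
    simp only [Set.mem_setOf_eq, hr, hinv, hρY, not_or, not_and, not_not]
    by_cases hx : r x ∈ R
    · have hρx : ρ • r x ∉ R := (hR (r x)).1 hx
      constructor
      · rintro (⟨-, hxS⟩ | ⟨hxR, -⟩)
        · exact ⟨fun h => absurd h hρx, fun _ => hxS⟩
        · exact absurd hx hxR
      · rintro ⟨-, h2⟩
        exact Or.inl ⟨hx, h2 hρx⟩
    · have hρx : ρ • r x ∈ R := by
        by_contra hnot
        exact hx ((hR (r x)).2 hnot)
      constructor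
      · rintro (⟨hxR, -⟩ | ⟨-, hxS⟩)
        · exact absurd hxR hx
        · exact ⟨fun _ => hxS, fun h => absurd hρx h⟩
      · rintro ⟨h1, -⟩
        exact Or.inr ⟨hx, h1 hρx⟩
  · -- fibre counts
    by_cases hy : y ∈ R
    · have heq : Finset.univ.filter (fun x => r x = y ∧
          x ∈ {x | (r x ∈ R ∧ x ∈ S (r x)) ∨ (r x ∉ R ∧ ρ • x ∉ S (r (ρ • x)))}) = S y := by
        ext x
        simp only [Finset.mem_filter, Finset.mem_univ, true_and, Set.mem_setOf_eq]
        constructor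
        · rintro ⟨rfl, (⟨-, hxS⟩ | ⟨hxR, -⟩)⟩
          · exact hxS
          · exact absurd hy hxR
        · intro hxS
          have hrx : r x = y := hSr hxS
          subst hrx
          exact ⟨rfl, Or.inl ⟨hy, hxS⟩⟩
      have hc := congrArg Finset.card heq
      rw [hScard] at hc
      convert hc
    · have hρy : ρ • y ∈ R := by
        by_contra hnot
        exact hy ((hR y).2 hnot)
      -- the fibre over `y` inside `Φ` is the complement of `ρ⁻¹ S(ρy)`
      have heq : Finset.univ.filter (fun x => r x = y ∧
          x ∈ {x | (r x ∈ R ∧ x ∈ S (r x)) ∨ (r x ∉ R ∧ ρ • x ∉ S (r (ρ • x)))}) =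
            (Finset.univ.filter (fun x => r x = y)).filter (fun x => x ∉ (S (ρ • y)).image (fun z => ρ • z)) := by
        ext x
        simp only [Finset.mem_filter, Finset.mem_univ, true_and, Set.mem_setOf_eq, Finset.mem_image]
        constructor
        · rintro ⟨rfl, (⟨hxR, -⟩ | ⟨-, hxS⟩)⟩
          · exact absurd hxR hy
          · refine ⟨rfl, ?_⟩
            rintro ⟨z, hz, rfl⟩
            rw [hinv] at hxS
            rw [hSr hz] at hxS
            exact hxS hz
        · rintro ⟨rfl, hnot⟩
          refine ⟨rfl, Or.inr ⟨hy, fun hxS => hnot ⟨ρ • x, ?_, hinv x⟩⟩⟩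
          rw [hr] at hxS
          exact hxS
      have himage_sub : (S (ρ • y)).image (fun z => ρ • z) ⊆ Finset.univ.filter (fun x => r x = y) := by
        intro x hx
        obtain ⟨z, hz, rfl⟩ := Finset.mem_image.1 hx
        simp only [Finset.mem_filter, Finset.mem_univ, true_and, hr, hSr hz, hρY]
      have hinj : Set.InjOn (fun z : X => ρ • z) ↑(S (ρ • y)) :=
        fun x _ x' _ hxx' => by simpa only [hinv] using congrArg (fun z => ρ • z) hxx'
      have hc := congrArg Finset.card heq
      rw [Finset.filter_not, Finset.filter_mem_eq_inter, Finset.inter_eq_right.2 himage_sub,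
        Finset.card_sdiff, Finset.inter_eq_left.2 himage_sub, Finset.card_image_of_injOn hinj, hScard, hf] at hc
      have hky := hk y
      convert hc
      omega

/-- **SURJECTIVITY OF THE SHADOW**: with the data above, every `k : Y → ℕ` with `k(y) + k(ρy) = f` is realised as
`w(y) = 2k(y) − f` by a CM type — the shadows of the CM types of `X` are EXACTLY the odd weights `w` on `Y` with
`w ≡ f (mod 2)` and `|w| ≤ f` (the `f`-fold sums of type vectors of `Y`). [cite: Gordon1999HodgeAVSurvey, 9.4.3]
[cite: Shimura1998, §18.1] -/
theorem exists_isCMTypeWith_forall_fibre_shadow_eq {ρ : G} (hcomm : ∀ (g : G) (x : X), g • ρ • x = ρ • g • x)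
    (hinv : ∀ x : X, ρ • ρ • x = x) (r : X → Y)
    (hr : ∀ x : X, r (ρ • x) = ρ • r x) (hρY : ∀ y : Y, ρ • ρ • y = y) (hfree : ∀ y : Y, ρ • y ≠ y) {f : ℕ}
    (hf : ∀ y : Y, (Finset.univ.filter (fun x => r x = y)).card = f) (k : Y → ℕ)
    (hk : ∀ y : Y, k y + k (ρ • y) = f) :
    ∃ Φ : Set X, IsCMTypeWith ρ Φ ∧
      ∀ y : Y, ∑ x ∈ Finset.univ.filter (fun x => r x = y), antiVec Φ (1 : G) x = 2 * (k y : ℚ) - f := by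
  obtain ⟨Φ, hΦ, hcount⟩ :=
    exists_isCMTypeWith_forall_card_fibre_inter_eq hcomm hinv r hr hρY hfree hf k hk
  exact ⟨Φ, hΦ, fun y => by rw [fibre_shadow_eq_two_mul_card_sub_card, hcount y, hf y]⟩

/-- **PADDING: LARGER INDEX OF THE SAME PARITY REALISES EVERY SHADOW OF THE SMALLER.**  If `r′ : X′ → Y` is a
`ρ`-compatible pivot with fibres of size `f′`, `r : X → Y` one with fibres of size `f = f′ + 2d`, then the shadow of
every CM type `Φ′ ⊆ X′` is the shadow of some CM type `Φ ⊆ X` (take `k = #(Φ′ ∩ r′⁻¹y) + d`).  With §2 the defect of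
`(Φ′, Φ₁)` is then the defect of `(Φ, Φ₁)` for every partner `Φ₁`. [cite: Gordon1999HodgeAVSurvey, 9.4.3]
[cite: Dodson1987, §1.1] -/
theorem exists_isCMTypeWith_fibre_shadow_eq_of_le_of_even {X' : Type u} [MulAction G X'] [Fintype X'] {ρ : G}
    (hcomm : ∀ (g : G) (x : X), g • ρ • x = ρ • g • x) (hinv : ∀ x : X, ρ • ρ • x = x)
    (r : X → Y) (hr : ∀ x : X, r (ρ • x) = ρ • r x)
    (hρY : ∀ y : Y, ρ • ρ • y = y) (hfree : ∀ y : Y, ρ • y ≠ y) {f : ℕ}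
    (hf : ∀ y : Y, (Finset.univ.filter (fun x => r x = y)).card = f) {Φ' : Set X'} (h' : IsCMTypeWith ρ Φ')
    (r' : X' → Y) (hr' : ∀ x : X', r' (ρ • x) = ρ • r' x) {f' : ℕ}
    (hf' : ∀ y : Y, (Finset.univ.filter (fun x => r' x = y)).card = f') {d : ℕ} (hd : f = f' + 2 * d) :
    ∃ Φ : Set X, IsCMTypeWith ρ Φ ∧
      ∀ y : Y, ∑ x ∈ Finset.univ.filter (fun x => r x = y), antiVec Φ (1 : G) x =
        ∑ x ∈ Finset.univ.filter (fun x => r' x = y), antiVec Φ' (1 : G) x := by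
  obtain ⟨Φ, hΦ, hw⟩ := exists_isCMTypeWith_forall_fibre_shadow_eq hcomm hinv r hr hρY hfree hf
    (fun y => (Finset.univ.filter (fun x => r' x = y ∧ x ∈ Φ')).card + d) fun y => by
      have := card_fibre_inter_add_card_fibre_inter_rho h' r' hr' hρY y
      rw [hf'] at this
      omega
  refine ⟨Φ, hΦ, fun y => ?_⟩
  rw [hw y, fibre_shadow_eq_two_mul_card_sub_card, hf' y, hd]
  push_cast
  ring

end Surjective

end Summit.HodgeConjecture.CorCM.IrrOdd

end
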